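import Literature.Probability.LatticeModels.CumulantRecursion
import Mathlib.RingTheory.PowerSeries.Basic
import Mathlib.Data.Nat.Choose.Cast
import HarnessLib

/-!
# The exponential formula for cumulants: `M' = K' · M` for exponential generating functions

Topic `Literature/Probability/LatticeModels`; continues `CumulantRecursion.lean`.  For a moment
sequence `μ` (`μ 0 = 1`) with cumulants `κ k = cumulantOf μ k`, the exponential generating
functions `M = Σ μₙ tⁿ/n!`, `K = Σ_{n ≥ 1} κₙ tⁿ/n!` satisfy `M' = K' M` — the differential form of
`M = exp K`, i.e. `log M = K`: Ruelle's `ψ = Γφ`, `φ = Γ⁻¹ψ` (1969, (4.5)–(4.6)) and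
`log ∫P(dψ) e^{λX} = Σₙ λⁿ 𝓔ᵀ(X; n)/n!` (Mastropietro 2008, (2.36); Benfatto–Giuliani–Mastropietro
2006, (2.13)–(2.14)) at the level of formal power series over a commutative `ℚ`-algebra.  Since the
derivative of an exponential generating function is the generating function of the shifted
sequence, the identity is stated shift-wise and needs no calculus.

* `egf a` (a `def`: `PowerSeries.mk (n ↦ a n / n!)`), `coeff_egf`;
* `egf_shift_eq_egf_cumulantOf_shift_mul` — `egf (n ↦ μ (n+1)) = egf (n ↦ κ (n+1)) * egf μ`.

## Sources

D. Ruelle, *Statistical Mechanics: Rigorous Results* (1969), §4.4.1 (4.5)–(4.7), PDF p. 77 of the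
held copy; bib key `Ruelle1969`.  V. Mastropietro, *Non-Perturbative Renormalization* (2008), §2.3
(2.35)–(2.36), PDF p. 35 of the held copy; bib key `Mastropietro2008`.
-/

open Finset PowerSeries

namespace Literature.Probability.LatticeModels

variable {C : Type*} [CommRing C] [Algebra ℚ C]

/-- The **exponential generating function** `Σₙ aₙ tⁿ/n!` of a sequence in a commutative
`ℚ`-algebra. [folklore] -/
noncomputable def egf (a : ℕ → C) : PowerSeries C :=
  PowerSeries.mk fun n => algebraMap ℚ C (n.factorial : ℚ)⁻¹ * a n

/-- Coefficients of `egf`. [folklore] -/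
theorem coeff_egf (a : ℕ → C) (n : ℕ) :
    coeff n (egf a) = algebraMap ℚ C (n.factorial : ℚ)⁻¹ * a n :=
  coeff_mk _ _

/-- **The exponential formula, differential form `M' = K' M`**: for `μ 0 = 1`,
`egf (n ↦ μ (n+1)) = egf (n ↦ κ (n+1)) · egf μ` with `κ = cumulantOf μ`, i.e. `M = exp K`,
`log M = K` for the exponential generating functions of moments and cumulants (Ruelle 1969,
(4.5)–(4.6); Mastropietro 2008, (2.36): `log ∫P(dψ)e^{X} = Σₙ 𝓔ᵀ(X;n)/n!`). [cite: Ruelle1969, §4.4.1 (4.5)-(4.7)] -/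
theorem egf_shift_eq_egf_cumulantOf_shift_mul (μ : ℕ → C) (hμ : μ 0 = 1) :
    egf (fun n => μ (n + 1)) = egf (fun n => cumulantOf μ (n + 1)) * egf μ := by
  ext n
  rw [coeff_egf, coeff_mul, Finset.Nat.sum_antidiagonal_eq_sum_range_succ_mk]
  simp only [coeff_egf]
  rw [moment_succ_eq_sum_choose_mul_cumulantOf μ hμ n, Finset.mul_sum]
  refine sum_congr rfl fun k hk => ?_
  have hkn : k ≤ n := Nat.lt_succ_iff.1 (mem_range.1 hk)
  have hq : (n.factorial : ℚ)⁻¹ * (n.choose k : ℚ) = (k.factorial : ℚ)⁻¹ * ((n - k).factorial : ℚ)⁻¹ := by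
    have hn : (n.factorial : ℚ) ≠ 0 := by positivity
    have hk' : (k.factorial : ℚ) ≠ 0 := by positivity
    have hnk : ((n - k).factorial : ℚ) ≠ 0 := by positivity
    rw [Nat.cast_choose ℚ hkn]
    field_simp
  have hC : algebraMap ℚ C (n.factorial : ℚ)⁻¹ * (n.choose k : C) =
      algebraMap ℚ C (k.factorial : ℚ)⁻¹ * algebraMap ℚ C ((n - k).factorial : ℚ)⁻¹ := by
    rw [← map_natCast (algebraMap ℚ C) (n.choose k), ← map_mul, hq, map_mul]
  calc algebraMap ℚ C (n.factorial : ℚ)⁻¹ * ((n.choose k : C) * cumulantOf μ (k + 1) * μ (n - k))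
      = algebraMap ℚ C (n.factorial : ℚ)⁻¹ * (n.choose k : C) * (cumulantOf μ (k + 1) * μ (n - k)) := by
        ring
    _ = algebraMap ℚ C (k.factorial : ℚ)⁻¹ * cumulantOf μ (k + 1) *
          (algebraMap ℚ C ((n - k).factorial : ℚ)⁻¹ * μ (n - k)) := by
        rw [hC]; ring

end Literature.Probability.LatticeModels
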